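import Summits.BirchSwinnertonDyer.BirchSwinnertonDyer.Theorems.SignedLowerHalvesSmallImageLowerHalfBothSignsRttEulerLayer
import Summits.BirchSwinnertonDyer.BirchSwinnertonDyer.Theorems.ResidualThetaTransportAtTwoResidualThetaMainConjectureAtTwoEulerLayerK
import Summits.BirchSwinnertonDyer.BirchSwinnertonDyer.Theorems.ResidualThetaTransportAtTwoResidualThetaMainConjectureAtTwoAnalyticLayerLawKAtTwo
import Summits.BirchSwinnertonDyer.BirchSwinnertonDyer.Theorems.SignedLowerHalvesSmallImageLowerHalfBothSignsRttLayerLawUndepleted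
import HarnessLib

/-!
# Route `SignedLowerHalves`, crux L `SmallImageLowerHalfBothSigns` (item stmt-BirchSwinnertonDyer-23599), line `rtt_w3` —
# the PARTNER-side analytic layer law over `𝒪` (brick AN_g of ENG / ENG_T2), part 2: the layer-`n` Euler factors of the
# partner `g` at ANY prime `p` in norm language — `λ_n(E_{v,n}(g)) = p^{v_p(f_ℓ)} · λ(P_{g,ℓ}(ℓ⁻¹(X+1)))`

Width seat `bsd-line-slh-p3-w3` g12 under LEAD `cruxlead-stmt-BirchSwinnertonDyer-23599` (cell `bsd-ssimc`); ROUTE-INDEPENDENT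
helper (`--supports stmt-BirchSwinnertonDyer-23599`); THEOREMS ONLY — no definition, no named fact, no `sorry`; closes nothing;
BSD is not proved by any of this.

WHAT. The `S₀`-depleted Mazur–Tate element of the partner `g` (registered stubs Kan₂ / ENG of line `rtt_w3`) multiplies
`θ_n(g)^ι` by the layer-`n` Euler factors `E_{v,n}(g) = P_{g,ℓ}(ℓ⁻¹ (X+1)^{e_{v,n}}) ∈ ℚ̄_p[X]`, `v = (ℓ)`, `ℓ ≠ p`,
`P_{g,ℓ}(T) = 1 − ι(a_ℓ(g)) T + 𝟙_{ℓ∤M} ℓ T²`, `e_{v,n} = (−f_ℓ mod pⁿ) = p^{v_p(f_ℓ)}·e′`, `p ∤ e′` (`f_ℓ` Greenberg–Vatsal's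
Frobenius exponent; LEAD's `SmallImageRttOneSided.val_toZModPow_neg_frobeniusExponent`, any `p`). For the RATIONAL side the LEAD
computed the `X`-order of `E_{v,n}(W) mod p` as Greenberg–Vatsal's `δ_W^{(v)} = s_ℓ·d_ℓ` (p743580, `ZMod p` currency). For the
PARTNER, whose coefficient `a = ι(a_ℓ(g))` is a `p`-adic integer of `ℚ̄_p` but not of `ℚ_p`, this file proves the same law in
NORM LANGUAGE and at EVERY prime (the tree had `p = 2`: `ResidualThetaLayer.layerEulerFactorK_two`):

> for `‖a‖ ≤ 1`, `ℓ ≠ p` and `n > v_p(f_ℓ)`: `E_{v,n} ≠ 0`, `‖E_{v,n}‖_sup = 1` and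
> `layerLambda E_{v,n} = p^{v_p(f_ℓ)} · layerLambda (P_{g,ℓ}(ℓ⁻¹(X+1)))`,

where `P_{g,ℓ}(ℓ⁻¹(X+1)) ∈ ℚ̄_p[X]` (degree `≤ 2`, sup norm `1`) is the layer-free local polynomial whose `layerLambda ∈ {0,1,2}` is
the multiplicity `d_ℓ(g)` of `ℓ̄⁻¹` as a root of the residual Euler polynomial `P̄_{g,ℓ}` — so the right-hand side is
`s_ℓ · d_ℓ(g)`, Greenberg–Vatsal's `δ` for the partner (Prop. (2.4)), with no residue field of `ℚ̄_p` in the statement.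

HOW (pure norm language). With `u₀ = ℓ⁻¹` (a unit) and `B = (X+1)^e − 1`: `E = α + β·B + γ·B²` and `P(u₀(X+1)) = α + β·X + γ·X²`
for `α = 1 − a u₀ + c u₀²`, `β = −a u₀ + 2c u₀²`, `γ = c u₀²` (`c ∈ {0, ℓ}`), all of norm `≤ 1`, one of norm `1`; `‖B‖_sup = 1`,
`B(0) = 0`, `λ(B) = p^t` for `e = p^t e′`, `p ∤ e′` (Frobenius in `𝔽_p⟦X⟧`, LEAD's `order_coe_X_add_one_pow_sub_one`, transferred by
`layerLambda_map_eq_of_order`). The abstract lemma `layerLambda_quadratic` (§2) reads `λ(α + βB + γB²) = λ(B)·N` with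
`N = (‖α‖ = 1 ? 0 : ‖β‖ = 1 ? 1 : 2)` by the ultrametric isosceles principle (main term `α` / `B(β + γB)` / `γB²`, error of sup norm
`< 1`); taking `B = X` gives `λ(α + βX + γX²) = N`.

* §1 `layerLambda_X_add_one_pow_sub_one` — `λ((X+1)^{p^t e′} − 1) = p^t`, sup norm `1` (any `p`, `p ∤ e′`).
* §2 `layerLambda_quadratic` — the abstract law over any ultrametric normed field.
* §3 `layerEulerFactorK_comp_eq` (algebra), `layerEulerFactorK` (the law for one place), `layerEulerProductK` (finite products over
  `S₀ ∌ p`: non-vanishing and `λ = Σ_v p^{v_p(f_ℓ)} λ(P_{g,ℓ}(ℓ⁻¹(X+1)))` once `n > v_p(f_ℓ)` on `S₀`).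

References: [GreenbergVatsal2000] §2 Prop. (2.4) (p. 22), §1 p. 9; [PollackWeston2011MT] §3.1; [Washington1997] §7.1;
[Shimura1971] Thm. 3.48 (integrality of `a_ℓ(g)`, used by callers via `ResidualThetaLayer.norm_embCoeff_le_one`).
-/

set_option autoImplicit false
-- D-0017: single-problem summit, the namespace repeats the problem name by design.
set_option linter.dupNamespace false
noncomputable section

open scoped Classical

open Polynomial NumberField IsDedekindDomain Literature.NumberTheory.EllipticCurves
  Literature.NumberTheory.EllipticCurves.GreenbergVatsal2000 Literature.NumberTheory.IwasawaTheory Rat.HeightOneSpectrum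
  Summit.BirchSwinnertonDyer.Rank1Residual.X2.EulerFactorInvariants
  Summit.BirchSwinnertonDyer.BirchSwinnertonDyer.Theorems.ThetaLayerLambdaCongruenceAtTwo
  Summit.BirchSwinnertonDyer.BirchSwinnertonDyer.Theorems.ResidualThetaLayer
  Summit.BirchSwinnertonDyer.BirchSwinnertonDyer.Theorems.SmallImageRttOneSided

namespace Summit.BirchSwinnertonDyer.BirchSwinnertonDyer.Theorems.SmallImageRttLayerLawK

/-! ## §1 The shift polynomial `(X+1)^e − 1` at any prime -/

section Shift

variable {p : ℕ} [hp : Fact p.Prime]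

/-- **`λ((X+1)^{p^t·e′} − 1) = p^t` and `‖(X+1)^{p^t·e′} − 1‖_sup = 1` in `ℚ̄_p[X]` for `p ∤ e′`** (Frobenius in `𝔽_p⟦X⟧`:
`(X+1)^{p^t e′} − 1 = (X^{p^t}+1)^{e′} − 1 = e′X^{p^t} + …`, the LEAD's `order_coe_X_add_one_pow_sub_one`, transferred to `ℚ̄_p`
by `layerLambda_map_eq_of_order`; the `p = 2` case is the tree's `layerLambda_X_add_one_pow_sub_one_two`). [cite: Washington1997, §7.1] -/
theorem layerLambda_X_add_one_pow_sub_one {t e' : ℕ} (he' : ¬ p ∣ e') :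
    layerLambda ((X + 1 : (PadicAlgCl p)[X]) ^ (p ^ t * e') - 1) = p ^ t ∧
      ((X + 1 : (PadicAlgCl p)[X]) ^ (p ^ t * e') - 1).supNorm = 1 := by
  set φ : ℤ_[p] →+* PadicAlgCl p := (algebraMap ℚ_[p] (PadicAlgCl p)).comp (algebraMap ℤ_[p] ℚ_[p]) with hφ
  set P : ℤ_[p][X] := (X + 1) ^ (p ^ t * e') - 1 with hP
  have hmap : P.map φ = (X + 1 : (PadicAlgCl p)[X]) ^ (p ^ t * e') - 1 := by
    rw [hP, Polynomial.map_sub, Polynomial.map_pow, Polynomial.map_add, Polynomial.map_X, Polynomial.map_one]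
  have hord : ((P.map (PadicInt.toZMod (p := p)) : (ZMod p)[X]) : PowerSeries (ZMod p)).order =
      ((p ^ t : ℕ) : ℕ∞) := by
    rw [hP, Polynomial.map_sub, Polynomial.map_pow, Polynomial.map_add, Polynomial.map_X, Polynomial.map_one,
      Polynomial.coe_sub, Polynomial.coe_one]
    exact order_coe_X_add_one_pow_sub_one he'
  have h := layerLambda_map_eq_of_order φ norm_algebraMap_comp_padicInt hord
  rwa [hmap] at h

/-- `((X+1)^e − 1)(0) = 0`. [folklore] -/
theorem coeff_zero_X_add_one_pow_sub_one {K : Type*} [CommRing K] (e : ℕ) :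
    ((X + 1 : K[X]) ^ e - 1).coeff 0 = 0 := by
  rw [coeff_sub, coeff_X_add_one_pow, Nat.choose_zero_right, Nat.cast_one, coeff_one_zero, sub_self]

end Shift

/-! ## §2 The abstract quadratic law `λ(α + βB + γB²) = λ(B)·λ(α + βX + γX²)` -/

section Quadratic

variable {K : Type*} [NormedField K] [IsUltrametricDist K]

/-- **The quadratic layer law.** Over an ultrametric normed field let `α, β, γ` have norm `≤ 1`, not all of norm `< 1`, and let
`B ∈ K[X]` have `B(0) = 0` and `‖B‖_sup = 1`. Then `E = α + β·B + γ·B²` is non-zero, `‖E‖_sup = 1`, and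
`layerLambda E = layerLambda B · N` with `N = 0` if `‖α‖ = 1`, `N = 1` if `‖α‖ < 1 = ‖β‖`, `N = 2` otherwise (isosceles principle:
the main term is `α`, resp. `B·(β + γB)`, resp. `γ·B²`, and the rest has sup norm `< 1`). [cite: PollackWeston2011MT, §3.1]
[cite: GreenbergVatsal2000, §2 Prop. (2.4) (p. 22)] -/
theorem layerLambda_quadratic {α β γ : K} (hα : ‖α‖ ≤ 1) (hβ : ‖β‖ ≤ 1) (hγ : ‖γ‖ ≤ 1)
    (hmax : ‖α‖ = 1 ∨ ‖β‖ = 1 ∨ ‖γ‖ = 1) {B : K[X]} (hB0 : B.coeff 0 = 0) (hBsup : B.supNorm = 1) :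
    (C α + C β * B + C γ * B ^ 2) ≠ 0 ∧ (C α + C β * B + C γ * B ^ 2).supNorm = 1 ∧
      layerLambda (C α + C β * B + C γ * B ^ 2) =
        layerLambda B * (if ‖α‖ = 1 then 0 else if ‖β‖ = 1 then 1 else 2) := by
  have hBne : B ≠ 0 := fun h ↦ by rw [h, supNorm_zero] at hBsup; exact zero_ne_one hBsup
  have hB2sup : (B ^ 2).supNorm = 1 := by rw [pow_two, supNorm_mul', hBsup, one_mul]
  have hB20 : (B ^ 2).coeff 0 = 0 := by
    rw [coeff_zero_eq_eval_zero, eval_pow, ← coeff_zero_eq_eval_zero, hB0, zero_pow two_ne_zero]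
  set E : K[X] := C α + C β * B + C γ * B ^ 2 with hE
  -- every coefficient of `E` has norm `≤ 1`
  have hEle : E.supNorm ≤ 1 := by
    refine (supNorm_add_le_max _ _).trans (max_le ((supNorm_add_le_max _ _).trans (max_le ?_ ?_)) ?_)
    · rw [supNorm_C]; exact hα
    · rw [ResidualThetaLayer.supNorm_C_mul, hBsup, mul_one]; exact hβ
    · rw [ResidualThetaLayer.supNorm_C_mul, hB2sup, mul_one]; exact hγ
  have hE0 : E.coeff 0 = α := by
    rw [hE, coeff_add, coeff_add, coeff_C_zero, coeff_C_mul, coeff_C_mul, hB0, hB20, mul_zero, mul_zero, add_zero,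
      add_zero]
  -- from `‖E‖_sup = 1` the non-vanishing follows
  have hne_of_sup : E.supNorm = 1 → E ≠ 0 := fun h h0 ↦ by
    rw [h0, supNorm_zero] at h; exact zero_ne_one h
  by_cases hα1 : ‖α‖ = 1
  · -- main term `α`: `λ = 0`
    rw [if_pos hα1, mul_zero]
    have hsup : E.supNorm = 1 :=
      supNorm_eq_of_forall_le E (fun i ↦ (E.le_supNorm i).trans hEle) (k := 0) (by rw [hE0, hα1])
    refine ⟨hne_of_sup hsup, hsup, ?_⟩
    rw [layerLambda_eq_iff, hsup]
    exact ⟨by rw [hE0, hα1], fun j hj ↦ absurd hj (Nat.not_lt_zero j)⟩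
  · rw [if_neg hα1]
    have hαlt : ‖α‖ < 1 := lt_of_le_of_ne hα hα1
    by_cases hβ1 : ‖β‖ = 1
    · -- main term `T = B·(β + γB)`: `λ(T) = λ(B) + 0`
      rw [if_pos hβ1, mul_one]
      set R : K[X] := C β + C γ * B with hR
      have hR0 : R.coeff 0 = β := by rw [hR, coeff_add, coeff_C_zero, coeff_C_mul, hB0, mul_zero, add_zero]
      have hRle : ∀ i, ‖R.coeff i‖ ≤ 1 := fun i ↦ (R.le_supNorm i).trans
        ((supNorm_add_le_max _ _).trans (max_le (by rw [supNorm_C]; exact hβ)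
          (by rw [ResidualThetaLayer.supNorm_C_mul, hBsup, mul_one]; exact hγ)))
      have hRsup : R.supNorm = 1 := supNorm_eq_of_forall_le R hRle (k := 0) (by rw [hR0, hβ1])
      have hRne : R ≠ 0 := fun h ↦ by rw [h, supNorm_zero] at hRsup; exact zero_ne_one hRsup
      have hRlam : layerLambda R = 0 := by
        rw [layerLambda_eq_iff, hRsup]
        exact ⟨by rw [hR0, hβ1], fun j hj ↦ absurd hj (Nat.not_lt_zero j)⟩
      set T : K[X] := B * R with hT
      have hTsup : T.supNorm = 1 := by rw [hT, supNorm_mul', hBsup, hRsup, mul_one]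
      have hTlam : layerLambda T = layerLambda B := by rw [hT, layerLambda_mul hBne hRne, hRlam, add_zero]
      have hdec : E = T + C α := by rw [hE, hT, hR]; ring
      have herr : (C α : K[X]).supNorm < T.supNorm := by rw [hTsup, supNorm_C]; exact hαlt
      have hsup : E.supNorm = 1 := by rw [hdec, supNorm_add_eq_left_of_supNorm_lt herr, hTsup]
      refine ⟨hne_of_sup hsup, hsup, ?_⟩
      rw [← hTlam]
      refine (layerLambda_eq_of_supNorm_sub_C_mul_lt (θ := T) (c := (1 : K)) one_ne_zero ?_).symm
      rw [map_one, one_mul, hdec, sub_add_cancel_left,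
        show ∀ S : K[X], -S = C (-1 : K) * S from fun S ↦ by simp, ResidualThetaLayer.supNorm_C_mul, norm_neg,
        norm_one, one_mul]
      exact herr
    · -- main term `T = γ·B²`: `λ(T) = 2λ(B)`
      rw [if_neg hβ1]
      have hβlt : ‖β‖ < 1 := lt_of_le_of_ne hβ hβ1
      have hγ1 : ‖γ‖ = 1 := by
        rcases hmax with h | h | h
        · exact absurd h hα1
        · exact absurd h hβ1
        · exact h
      have hγ0 : γ ≠ 0 := norm_pos_iff.mp (by rw [hγ1]; exact one_pos)
      set T : K[X] := C γ * B ^ 2 with hT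
      have hTsup : T.supNorm = 1 := by rw [hT, ResidualThetaLayer.supNorm_C_mul, hγ1, hB2sup, one_mul]
      have hTlam : layerLambda T = layerLambda B * 2 := by
        rw [hT, ResidualThetaLayer.layerLambda_C_mul hγ0, pow_two, layerLambda_mul hBne hBne]; ring
      have hdec : E = T + (C α + C β * B) := by rw [hE, hT]; ring
      have herr : (C α + C β * B : K[X]).supNorm < T.supNorm := by
        rw [hTsup]
        refine (supNorm_add_le_max _ _).trans_lt (max_lt ?_ ?_)
        · rw [supNorm_C]; exact hαlt
        · rw [ResidualThetaLayer.supNorm_C_mul, hBsup, mul_one]; exact hβlt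
      have hsup : E.supNorm = 1 := by rw [hdec, supNorm_add_eq_left_of_supNorm_lt herr, hTsup]
      refine ⟨hne_of_sup hsup, hsup, ?_⟩
      rw [← hTlam]
      refine (layerLambda_eq_of_supNorm_sub_C_mul_lt (θ := T) (c := (1 : K)) one_ne_zero ?_).symm
      rw [map_one, one_mul, hdec, sub_add_cancel_left,
        show ∀ S : K[X], -S = C (-1 : K) * S from fun S ↦ by simp, ResidualThetaLayer.supNorm_C_mul, norm_neg,
        norm_one, one_mul]
      exact herr

/-- The case `B = X` of `layerLambda_quadratic`: `λ(α + βX + γX²) = N`, sup norm `1`, non-zero. [cite: PollackWeston2011MT, §3.1] -/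
theorem layerLambda_quadratic_X {α β γ : K} (hα : ‖α‖ ≤ 1) (hβ : ‖β‖ ≤ 1) (hγ : ‖γ‖ ≤ 1)
    (hmax : ‖α‖ = 1 ∨ ‖β‖ = 1 ∨ ‖γ‖ = 1) :
    (C α + C β * X + C γ * X ^ 2 : K[X]) ≠ 0 ∧ (C α + C β * X + C γ * X ^ 2 : K[X]).supNorm = 1 ∧
      layerLambda (C α + C β * X + C γ * X ^ 2 : K[X]) = (if ‖α‖ = 1 then 0 else if ‖β‖ = 1 then 1 else 2) := by
  have hXsup : (X : K[X]).supNorm = 1 := by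
    refine supNorm_eq_of_forall_le (X : K[X]) (fun i ↦ ?_) (k := 1) (by rw [coeff_X_one, norm_one])
    by_cases hi : i = 1
    · rw [hi, coeff_X_one, norm_one]
    · rw [coeff_X_of_ne_one hi, norm_zero]; exact zero_le_one
  have hXlam : layerLambda (X : K[X]) = 1 := by
    rw [layerLambda_eq_iff, hXsup]
    refine ⟨by rw [coeff_X_one, norm_one], fun j hj ↦ ?_⟩
    rw [Nat.lt_one_iff.mp hj, coeff_X_zero, norm_zero]; exact one_pos
  obtain ⟨h1, h2, h3⟩ := layerLambda_quadratic hα hβ hγ hmax (B := (X : K[X])) coeff_X_zero hXsup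
  exact ⟨h1, h2, by rw [h3, hXlam, one_mul]⟩

end Quadratic

/-! ## §3 The layer Euler factor of the partner at any prime -/

section Euler

variable {p : ℕ} [hp : Fact p.Prime] (M : ℕ) (v : HeightOneSpectrum (𝓞 ℚ)) (a : PadicAlgCl p)

/-- **Algebra of the layer substitution**: with `u₀ = ℓ⁻¹`, `c = 𝟙_{ℓ∤M}·ℓ` and `B = R − 1`,
`(1 − aT + cT²)(u₀ R) = (1 − a u₀ + c u₀²) + (−a u₀ + 2c u₀²)·(R − 1) + c u₀²·(R − 1)²` for every `R ∈ ℚ̄_p[X]`. [folklore] -/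
theorem layerEulerFactorK_comp_eq (R : (PadicAlgCl p)[X]) :
    (1 - C a * X + (if natGenerator v ∣ M then 0 else C (natGenerator v : PadicAlgCl p)) * X ^ 2).comp
        (C ((natGenerator v : PadicAlgCl p)⁻¹) * R) =
      C (1 - a * (natGenerator v : PadicAlgCl p)⁻¹ +
            (if natGenerator v ∣ M then 0 else (natGenerator v : PadicAlgCl p)) * (natGenerator v : PadicAlgCl p)⁻¹ ^ 2) +
        C (-(a * (natGenerator v : PadicAlgCl p)⁻¹) +
            2 * (if natGenerator v ∣ M then 0 else (natGenerator v : PadicAlgCl p)) * (natGenerator v : PadicAlgCl p)⁻¹ ^ 2) *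
          (R - 1) +
        C ((if natGenerator v ∣ M then 0 else (natGenerator v : PadicAlgCl p)) * (natGenerator v : PadicAlgCl p)⁻¹ ^ 2) *
          (R - 1) ^ 2 := by
  have hc : (if natGenerator v ∣ M then (0 : (PadicAlgCl p)[X]) else C (natGenerator v : PadicAlgCl p)) =
      C (if natGenerator v ∣ M then 0 else (natGenerator v : PadicAlgCl p)) := by
    split_ifs <;> simp
  rw [hc, add_comp, sub_comp, one_comp, mul_comp, C_comp, X_comp, mul_comp, C_comp, pow_comp, X_comp]
  simp only [map_add, map_sub, map_mul, map_neg, map_pow, map_one, map_ofNat]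
  ring

/-- **The abstract layer Euler factor.** For `l, a, c ∈ ℚ̄_p` with `‖l‖ = 1`, `‖a‖ ≤ 1`, `‖c‖ ≤ 1` and `e = p^t·e′` with `p ∤ e′`,
put `u₀ = l⁻¹`, `α = 1 − a u₀ + c u₀²`, `β = −a u₀ + 2c u₀²`, `γ = c u₀²`, `B = (X+1)^e − 1`. Then `E = α + βB + γB²` is non-zero of
sup norm `1` and `layerLambda E = p^t · layerLambda (α + βX + γX²)`. [cite: GreenbergVatsal2000, §2 Prop. (2.4) (p. 22)]
[cite: PollackWeston2011MT, §3.1] -/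
theorem layerEulerFactorK_aux {l a c : PadicAlgCl p} (hl1 : ‖l‖ = 1) (ha : ‖a‖ ≤ 1) (hcle : ‖c‖ ≤ 1) {t e' : ℕ}
    (he' : ¬ p ∣ e') :
    (C (1 - a * l⁻¹ + c * l⁻¹ ^ 2) + C (-(a * l⁻¹) + 2 * c * l⁻¹ ^ 2) * ((X + 1) ^ (p ^ t * e') - 1) +
        C (c * l⁻¹ ^ 2) * ((X + 1) ^ (p ^ t * e') - 1) ^ 2 : (PadicAlgCl p)[X]) ≠ 0 ∧
    (C (1 - a * l⁻¹ + c * l⁻¹ ^ 2) + C (-(a * l⁻¹) + 2 * c * l⁻¹ ^ 2) * ((X + 1) ^ (p ^ t * e') - 1) +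
        C (c * l⁻¹ ^ 2) * ((X + 1) ^ (p ^ t * e') - 1) ^ 2 : (PadicAlgCl p)[X]).supNorm = 1 ∧
    layerLambda (C (1 - a * l⁻¹ + c * l⁻¹ ^ 2) + C (-(a * l⁻¹) + 2 * c * l⁻¹ ^ 2) * ((X + 1) ^ (p ^ t * e') - 1) +
        C (c * l⁻¹ ^ 2) * ((X + 1) ^ (p ^ t * e') - 1) ^ 2 : (PadicAlgCl p)[X]) =
      p ^ t * layerLambda (C (1 - a * l⁻¹ + c * l⁻¹ ^ 2) + C (-(a * l⁻¹) + 2 * c * l⁻¹ ^ 2) * X +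
        C (c * l⁻¹ ^ 2) * X ^ 2 : (PadicAlgCl p)[X]) := by
  set α : PadicAlgCl p := 1 - a * l⁻¹ + c * l⁻¹ ^ 2 with hαdef
  set β : PadicAlgCl p := -(a * l⁻¹) + 2 * c * l⁻¹ ^ 2 with hβdef
  set γ : PadicAlgCl p := c * l⁻¹ ^ 2 with hγdef
  -- norms: `‖u₀‖ = 1`, the three coefficients have norm `≤ 1`, one of them norm `1`
  have hu : ‖l⁻¹‖ = 1 := by rw [norm_inv, hl1, inv_one]
  have hau : ‖a * l⁻¹‖ ≤ 1 := by rw [norm_mul, hu, mul_one]; exact ha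
  have hcu : ‖c * l⁻¹ ^ 2‖ = ‖c‖ := by rw [norm_mul, norm_pow, hu, one_pow, mul_one]
  have h2c : ‖2 * c * l⁻¹ ^ 2‖ ≤ ‖c‖ := by
    rw [mul_assoc, norm_mul, hcu]
    have h2 : ‖(2 : PadicAlgCl p)‖ ≤ 1 := by
      have := Literature.NumberTheory.LFunctions.PadicRootsOfUnity.norm_natCast_le_one (p := p) 2
      rwa [Nat.cast_ofNat] at this
    exact mul_le_of_le_one_left (norm_nonneg _) h2
  have hα : ‖α‖ ≤ 1 := by
    rw [hαdef, sub_eq_add_neg]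
    refine (IsUltrametricDist.norm_add_le_max _ _).trans (max_le ((IsUltrametricDist.norm_add_le_max _ _).trans
      (max_le (by rw [norm_one]) (by rw [norm_neg]; exact hau))) (by rw [hcu]; exact hcle))
  have hβ : ‖β‖ ≤ 1 :=
    (IsUltrametricDist.norm_add_le_max _ _).trans (max_le (by rw [norm_neg]; exact hau) (h2c.trans hcle))
  have hγ : ‖γ‖ ≤ 1 := by rw [hγdef, hcu]; exact hcle
  have hmax : ‖α‖ = 1 ∨ ‖β‖ = 1 ∨ ‖γ‖ = 1 := by
    by_cases hc1 : ‖c‖ = 1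
    · exact Or.inr (Or.inr (by rw [hγdef, hcu, hc1]))
    · have hclt : ‖c‖ < 1 := lt_of_le_of_ne hcle hc1
      have h2clt : ‖2 * c * l⁻¹ ^ 2‖ < 1 := h2c.trans_lt hclt
      have hcult : ‖c * l⁻¹ ^ 2‖ < 1 := by rw [hcu]; exact hclt
      by_cases ha1 : ‖a‖ = 1
      · refine Or.inr (Or.inl ?_)
        have hau1 : ‖-(a * l⁻¹)‖ = 1 := by rw [norm_neg, norm_mul, hu, mul_one, ha1]
        have h3 : ‖-(a * l⁻¹) - β‖ < ‖-(a * l⁻¹)‖ := by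
          rw [hβdef, show -(a * l⁻¹) - (-(a * l⁻¹) + 2 * c * l⁻¹ ^ 2) = -(2 * c * l⁻¹ ^ 2) by ring, norm_neg, hau1]
          exact h2clt
        rw [norm_eq_of_norm_sub_lt_norm h3, hau1]
      · refine Or.inl ?_
        have halt : ‖a * l⁻¹‖ < 1 := by rw [norm_mul, hu, mul_one]; exact lt_of_le_of_ne ha ha1
        have h3 : ‖(1 : PadicAlgCl p) - α‖ < ‖(1 : PadicAlgCl p)‖ := by
          rw [hαdef, show (1 : PadicAlgCl p) - (1 - a * l⁻¹ + c * l⁻¹ ^ 2) = a * l⁻¹ + -(c * l⁻¹ ^ 2) by ring,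
            norm_one]
          exact (IsUltrametricDist.norm_add_le_max _ _).trans_lt (max_lt halt (by rw [norm_neg]; exact hcult))
        rw [norm_eq_of_norm_sub_lt_norm h3, norm_one]
  -- the shift polynomial and the two instances of the quadratic law
  obtain ⟨hBlam, hBsup⟩ := layerLambda_X_add_one_pow_sub_one (p := p) (t := t) he'
  have hB0 := coeff_zero_X_add_one_pow_sub_one (K := PadicAlgCl p) (p ^ t * e')
  obtain ⟨hEne, hEsup, hElam⟩ := layerLambda_quadratic hα hβ hγ hmax hB0 hBsup
  obtain ⟨-, -, hQlam⟩ := layerLambda_quadratic_X hα hβ hγ hmax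
  exact ⟨hEne, hEsup, by rw [hElam, hQlam, hBlam]⟩

/-- **The layer Euler factor of the partner at any prime: non-vanishing, `μ = 0`, and its layer `λ`.** For a place `v = (ℓ)` with
`ℓ ≠ p`, `‖a‖ ≤ 1` (`a = ι(a_ℓ(g))`, Shimura 3.48) and a layer `n > v_p(f_ℓ)`, the polynomial
`E_{v,n} = (1 − aT + 𝟙_{ℓ∤M} ℓ T²) ∘ (ℓ⁻¹(X+1)^{e_{v,n}})`, `e_{v,n} = (−f_ℓ mod pⁿ)`, satisfies `E_{v,n} ≠ 0`, `‖E_{v,n}‖_sup = 1` and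
`layerLambda E_{v,n} = p^{v_p(f_ℓ)} · layerLambda ((1 − aT + 𝟙_{ℓ∤M} ℓ T²) ∘ (ℓ⁻¹(X+1)))` — Greenberg–Vatsal's `s_ℓ · d_ℓ` for the
partner, `d_ℓ ∈ {0,1,2}` being the layer-free `λ` of `P_{g,ℓ}(ℓ⁻¹(X+1))` (the multiplicity of `ℓ̄⁻¹` as a root of `P̄_{g,ℓ}`).
[cite: GreenbergVatsal2000, §2 Prop. (2.4) (p. 22)] [cite: PollackWeston2011MT, §3.1] -/
theorem layerEulerFactorK (hℓ : natGenerator v ≠ p) (ha : ‖a‖ ≤ 1) {n : ℕ}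
    (hn : (frobeniusExponent p (natGenerator v : ℤ_[p])).valuation < n) :
    (1 - C a * X + (if natGenerator v ∣ M then 0 else C (natGenerator v : PadicAlgCl p)) * X ^ 2).comp
        (C ((natGenerator v : PadicAlgCl p)⁻¹) *
          (X + 1) ^ (PadicInt.toZModPow n (-(frobeniusExponent p (natGenerator v : ℤ_[p])))).val) ≠ 0 ∧
    ((1 - C a * X + (if natGenerator v ∣ M then 0 else C (natGenerator v : PadicAlgCl p)) * X ^ 2).comp
        (C ((natGenerator v : PadicAlgCl p)⁻¹) *
          (X + 1) ^ (PadicInt.toZModPow n (-(frobeniusExponent p (natGenerator v : ℤ_[p])))).val)).supNorm = 1 ∧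
    layerLambda ((1 - C a * X + (if natGenerator v ∣ M then 0 else C (natGenerator v : PadicAlgCl p)) * X ^ 2).comp
        (C ((natGenerator v : PadicAlgCl p)⁻¹) *
          (X + 1) ^ (PadicInt.toZModPow n (-(frobeniusExponent p (natGenerator v : ℤ_[p])))).val)) =
      p ^ (frobeniusExponent p (natGenerator v : ℤ_[p])).valuation *
        layerLambda ((1 - C a * X + (if natGenerator v ∣ M then 0 else C (natGenerator v : PadicAlgCl p)) * X ^ 2).comp
          (C ((natGenerator v : PadicAlgCl p)⁻¹) * (X + 1))) := by
  obtain ⟨hcop, -⟩ := coprime_natGenerator v (p := p) hℓ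
  obtain ⟨e', he', he⟩ := val_toZModPow_neg_frobeniusExponent (p := p) v hℓ hn
  have hl1 : ‖(natGenerator v : PadicAlgCl p)‖ = 1 := by
    rw [← map_natCast ((algebraMap ℚ_[p] (PadicAlgCl p)).comp (algebraMap ℤ_[p] ℚ_[p])) (natGenerator v),
      norm_algebraMap_comp_padicInt]
    exact PadicInt.norm_natCast_eq_one_iff.mpr hcop
  have hcle : ‖(if natGenerator v ∣ M then (0 : PadicAlgCl p) else (natGenerator v : PadicAlgCl p))‖ ≤ 1 := by
    split_ifs
    · rw [norm_zero]; exact zero_le_one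
    · exact hl1.le
  have hQ := layerEulerFactorK_comp_eq (p := p) M v a (X + 1)
  rw [add_sub_cancel_right] at hQ
  rw [he, layerEulerFactorK_comp_eq (p := p) M v a ((X + 1) ^ _), hQ]
  exact layerEulerFactorK_aux hl1 ha hcle he'

/-- **The layer depletion product of the partner**: for a finite set `S₀` of places `≠ p`, integral coefficients `a_v`
(`‖a_v‖ ≤ 1`) and a layer `n` exceeding every `v_p(f_ℓ)`, `v ∈ S₀`, the product `∏_{v∈S₀} E_{v,n}` is non-zero and
`layerLambda (∏_{v∈S₀} E_{v,n}) = Σ_{v∈S₀} p^{v_p(f_ℓ)} · layerLambda (P_{g,ℓ}(ℓ⁻¹(X+1)))` (Gauss's lemma with `λ`; the layer-`n` form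
of Greenberg–Vatsal's display (9) for the partner). [cite: GreenbergVatsal2000, §1 p. 9 (display (9)) and §2 Prop. (2.4)]
[cite: PollackWeston2011MT, §3.1] -/
theorem layerEulerProductK (S₀ : Finset (HeightOneSpectrum (𝓞 ℚ))) (hS : ∀ v ∈ S₀, natGenerator v ≠ p)
    (av : HeightOneSpectrum (𝓞 ℚ) → PadicAlgCl p) (hav : ∀ v ∈ S₀, ‖av v‖ ≤ 1) {n : ℕ}
    (hn : ∀ v ∈ S₀, (frobeniusExponent p (natGenerator v : ℤ_[p])).valuation < n) :
    (∏ v ∈ S₀, (1 - C (av v) * X + (if natGenerator v ∣ M then 0 else C (natGenerator v : PadicAlgCl p)) * X ^ 2).comp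
        (C ((natGenerator v : PadicAlgCl p)⁻¹) *
          (X + 1) ^ (PadicInt.toZModPow n (-(frobeniusExponent p (natGenerator v : ℤ_[p])))).val)) ≠ 0 ∧
    layerLambda (∏ v ∈ S₀, (1 - C (av v) * X +
          (if natGenerator v ∣ M then 0 else C (natGenerator v : PadicAlgCl p)) * X ^ 2).comp
        (C ((natGenerator v : PadicAlgCl p)⁻¹) *
          (X + 1) ^ (PadicInt.toZModPow n (-(frobeniusExponent p (natGenerator v : ℤ_[p])))).val)) =
      ∑ v ∈ S₀, p ^ (frobeniusExponent p (natGenerator v : ℤ_[p])).valuation *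
        layerLambda ((1 - C (av v) * X + (if natGenerator v ∣ M then 0 else C (natGenerator v : PadicAlgCl p)) * X ^ 2).comp
          (C ((natGenerator v : PadicAlgCl p)⁻¹) * (X + 1))) := by
  have hE : ∀ v ∈ S₀, _ := fun v hv ↦ layerEulerFactorK (p := p) M v (av v) (hS v hv) (hav v hv) (hn v hv)
  obtain ⟨hne, hlam⟩ := prod_ne_zero_and_layerLambda_prod S₀ _ fun v hv ↦ (hE v hv).1
  refine ⟨hne, ?_⟩
  rw [hlam]
  exact Finset.sum_congr rfl fun v hv ↦ (hE v hv).2.2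

end Euler

end Summit.BirchSwinnertonDyer.BirchSwinnertonDyer.Theorems.SmallImageRttLayerLawK

end
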